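import Literature.Probability.Percolation.NearCriticalFourArmFacts
import Literature.Probability.Percolation.TriCorrLengthLeaves
import HarnessLib

/-!
# The equivalence of lengths `L_ε ≍ L_{ε'}` (Nolin's Cor. 37) from Kesten's relation, and the
# all-`ε` radius decay from the current leaves (proofs only)

Topic `Literature/Probability/Percolation`; family `crit-perc`. Proofs only (no new definition, no
new named fact). The named fact `Literature.Probability.Percolation.Nolin2008_radius_decay`
(`NearCriticalCorrelationLength.lean`: the radius decay of the finite cluster of the origin beyond
`k · L_ε(p)`, for EVERY `ε ∈ (0, 1/2)`) is reduced here to four EXISTING named facts of the tree —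
the "moreover" clause `Nolin2008_RSW_one` of the Russo–Seymour–Welsh theorem, Kesten's relation
`Nolin2008_prop34`, and Werner's two uniform four-arm estimates `Werner2009_fourArm_quasiMult`,
`Werner2009_fourArm_lowerBound` (used at `p = 1/2` only) — following the printed proof:

* Nolin 2008, proof of Lemma 39 [arXiv 0711.4948: Lemma 37], last paragraph: the block argument
  proves the uniform exponential decay "for any `ε` below some fixed value `ε₀` (given by RSW). The
  result for any `ε ∈ (0, 1/2)` follows readily by using the equivalence of lengths for different
  values of `ε` (Corollary 35 [EJP: Cor. 37])". In the tree: `Nolin2008_lemma39_at_of_RSW_one`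
  (`NearCriticalExpDecay.lean`) and `Nolin2008_lemma39_at_of_charLength_le`
  (`TriCorrLengthLeaves.lean`).
* Nolin 2008, Cor. 37 [arXiv: Cor. 35], `L_ε(p) ≍ L_{ε'}(p)`, proof: "assume that `ε ≤ ε'`, so
  that `L_ε(p) ≥ L_{ε'}(p)` … We know that
  `|p - 1/2| L_ε² π₄(L_ε) ≍ 1 ≍ |p - 1/2| L_{ε'}² π₄(L_{ε'})` [Prop. 32 = EJP Prop. 34, the tree's
  `Nolin2008_prop34`], hence `L_ε² π₄(L_ε) / (L_{ε'}² π₄(L_{ε'})) ≤ C₁`. This yields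
  `(L_ε/L_{ε'})² ≤ C₁ π₄(L_{ε'})/π₄(L_ε) ≤ C₂ π₄(L_{ε'}, L_ε)⁻¹` by quasi-multiplicativity. Now we use
  the a-priori bound for 4 arms given by the 5-arm exponent:
  `π₄(L_{ε'}, L_ε) ≥ C₃ (L_{ε'}/L_ε)^{2-α'}`. Together with the previous equation, it implies the
  result: `L_ε(p) ≤ C₄^{1/α'} L_{ε'}(p)`." Here (`charLength_le_mul_charLength_of_scaling`, with the
  roles of `ε`, `ε'` exchanged so that `ε' ≤ ε` and `L_ε ≤ L_{ε'}`): quasi-multiplicativity is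
  Werner's Cor. 6.2 at `p = 1/2`, `c π₄(r₀, L_ε) π₄(4 L_ε, L_{ε'}) ≤ π₄(r₀, L_{ε'})` (when
  `L_{ε'} > 4 L_ε`; otherwise there is nothing to prove), and the a priori bound is Werner's §3
  estimate at `p = 1/2`, `π₄(4 L_ε, L_{ε'}) ≥ c (4 L_ε / L_{ε'})^{2-β}`; the arithmetic is
  `ratio_rpow_le_of_scaling`. The inner radius `r₀` is common to the two instances of Kesten's
  relation and above the thresholds of both estimates, and `L_ε(p) > 4 r₀` near `1/2`
  (`tendsto_charLength_atTop`).

Results: `charLength_le_mul_charLength_of_scaling` (Cor. 37, the half `L_{ε'} ≤ K L_ε` for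
`ε' ≤ ε`; the other half is `charLength_anti`, unconditionally), `Nolin2008_lemma39_at_of_leaves`
(Lemma 39 / Remark 40 at EVERY `ε ∈ (0, 1/2)` from the four leaves),
`Nolin2008_radius_decay_of_leaves` (the all-`ε` radius decay from the four leaves) and
`Nolin2008_radius_decay_of_leaves'` (the same with Kesten's relation replaced by the pivotal count
`Werner2009_lemma62`, through `Nolin2008_prop34_of_expDecay`). The discharge
`Nolin2008_radius_decay_holds` is thus `Nolin2008_radius_decay_of_leaves` applied to the four
`_holds` theorems of the leaves, once they land.

Conventions. Werner's facts are recorded for `fourArmProbAt t` and his length `charLengthW`; at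
`t = 1/2 = half` the length restriction is void and `fourArmProbAt half = critFourArmProb`
(`fourArmProbAt_half`), the four-arm probability of `Nolin2008_prop34`; no comparison between
`charLength` and `charLengthW` is needed.

## References

* P. Nolin, Near-critical percolation in two dimensions, *Electron. J. Probab.* 13 (2008), §7.3
  Prop. 34, Cor. 37; §7.4 Lemma 39 / Remark 40; §7.5 proof of Lemma 44 (arXiv 0711.4948: Prop. 32,
  Cor. 35, Lemma 37 / Remark 38, Lemma 42) [Nolin2008].
* W. Werner, *Lectures on two-dimensional critical percolation*, PCMI (2009), Lecture 6, §3 and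
  Cor. 6.2 [WernerPCMI2009].
* H. Kesten, Scaling relations for 2D-percolation, *Comm. Math. Phys.* 109 (1987)
  [KestenScalingCMP1987].

Tree: `Nolin2008_prop34`, `critFourArmProb`, `charLength`, `tendsto_charLength_atTop`
(`KestenScaling.lean`); `Werner2009_fourArm_quasiMult`, `Werner2009_fourArm_lowerBound`
(`NearCriticalFourArmFacts.lean`); `fourArmProbAt_half` (`WernerPivotalEstimates.lean`);
`charLength_anti`, `Nolin2008_subcritical_crossing_of_expDecay`, `Nolin2008_prop34_of_expDecay`
(`KestenRelationRussoProofs.lean`); `BollobasRiordan2006_tri_expDecay_holds`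
(`TriSubcriticalCrossingProofs.lean`); `Nolin2008_lemma39_at_of_RSW_one` (`NearCriticalExpDecay.lean`);
`Nolin2008_lemma39_at_of_charLength_le` (`TriCorrLengthLeaves.lean`);
`Nolin2008_radius_decay_at_of_lemma39_at'` (`NearCriticalFiniteClusterDecay.lean`). Mathlib: `Real.rpow`
(`Real.div_rpow`, `Real.rpow_sub`, `Real.rpow_rpow_inv`, `Real.rpow_le_rpow`), `Metric.eventually_nhds_iff`.
-/

noncomputable section

open Filter Topology Set
open scoped unitInterval

namespace Literature.Probability.Percolation

open LatticeModels

/-! ### The arithmetic of the proof of Cor. 37 -/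

/-- **The arithmetic of Nolin's proof of Cor. 37.** If `c₁ ≤ a L² P`, `a L'² P' ≤ C₂` (Kesten's
relation at the two lengths), `c_q P P_m ≤ P'` (quasi-multiplicativity) and
`c_l (4L/L')^{2-β} ≤ P_m` (the a priori four-arm bound), with positive `a, L, L', c₁, c_q, c_l, β`
and `P ≥ 0`, then `L' ≤ Q^{1/β} L` with `Q = C₂ / (c_q c_l c₁ 4^{2-β})`: indeed the four
inequalities give `c_q c_l c₁ 4^{2-β} (L'/L)^β ≤ C₂`. [cite: Nolin2008, §7.3, proof of Cor. 37 (arXiv 0711.4948: Cor. 35)] -/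
theorem ratio_rpow_le_of_scaling {a L L' P P' Pm c₁ C₂ cq cl β : ℝ}
    (ha : 0 < a) (hL : 0 < L) (hL' : 0 < L') (hP : 0 ≤ P) (hc₁ : 0 < c₁) (hcq : 0 < cq)
    (hcl : 0 < cl) (hβ : 0 < β)
    (h1 : c₁ ≤ a * L ^ 2 * P) (h2 : a * L' ^ 2 * P' ≤ C₂)
    (h3 : cq * (P * Pm) ≤ P') (h4 : cl * (4 * L / L') ^ (2 - β) ≤ Pm) :
    L' ≤ (C₂ / (cq * cl * c₁ * (4 : ℝ) ^ (2 - β))) ^ β⁻¹ * L := by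
  set x : ℝ := L' / L with hx
  have hxpos : 0 < x := div_pos hL' hL
  have hL'eq : L' = x * L := by rw [hx]; field_simp
  have h4pow : (0 : ℝ) < (4 : ℝ) ^ (2 - β) := Real.rpow_pos_of_pos (by norm_num) _
  have hxpow : (0 : ℝ) < x ^ (2 - β) := Real.rpow_pos_of_pos hxpos _
  have hD : (4 * L / L') ^ (2 - β) = (4 : ℝ) ^ (2 - β) / x ^ (2 - β) := by
    rw [show 4 * L / L' = 4 / x by rw [hx]; field_simp, Real.div_rpow (by norm_num) hxpos.le]
  rw [hD] at h4
  -- chain the four inequalities into `c_q c_l c₁ 4^{2-β} x^β ≤ C₂`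
  have hP' : cq * (P * (cl * ((4 : ℝ) ^ (2 - β) / x ^ (2 - β)))) ≤ P' :=
    le_trans (mul_le_mul_of_nonneg_left (mul_le_mul_of_nonneg_left h4 hP) hcq.le) h3
  have h2' : a * L' ^ 2 * (cq * (P * (cl * ((4 : ℝ) ^ (2 - β) / x ^ (2 - β))))) ≤ C₂ :=
    le_trans (mul_le_mul_of_nonneg_left hP' (by positivity)) h2
  have hPlow : c₁ / (a * L ^ 2) ≤ P := by
    rw [div_le_iff₀ (by positivity)]
    linarith [h1]
  have h5 : a * L' ^ 2 * (cq * (c₁ / (a * L ^ 2) * (cl * ((4 : ℝ) ^ (2 - β) / x ^ (2 - β))))) ≤ C₂ :=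
    le_trans (by gcongr) h2'
  have hxβ : x ^ (2 : ℝ) / x ^ (2 - β) = x ^ β := by
    rw [← Real.rpow_sub hxpos]
    congr 1
    ring
  have hlhs : a * L' ^ 2 * (cq * (c₁ / (a * L ^ 2) * (cl * ((4 : ℝ) ^ (2 - β) / x ^ (2 - β))))) =
      cq * cl * c₁ * (4 : ℝ) ^ (2 - β) * x ^ β := by
    rw [← hxβ, Real.rpow_two, hL'eq]
    field_simp
  rw [hlhs] at h5
  -- solve for `x`
  have hkpos : 0 < cq * cl * c₁ * (4 : ℝ) ^ (2 - β) := by positivity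
  have hxQ : x ^ β ≤ C₂ / (cq * cl * c₁ * (4 : ℝ) ^ (2 - β)) := by
    rw [le_div_iff₀ hkpos]
    linarith [h5]
  have hxle : x ≤ (C₂ / (cq * cl * c₁ * (4 : ℝ) ^ (2 - β))) ^ β⁻¹ := by
    have := Real.rpow_le_rpow (Real.rpow_nonneg hxpos.le β) hxQ (inv_nonneg.2 hβ.le)
    rwa [Real.rpow_rpow_inv hxpos.le hβ.ne'] at this
  rw [hL'eq]
  exact mul_le_mul_of_nonneg_right hxle hL.le

/-! ### Cor. 37: `L_{ε'} ≤ K · L_ε` near `1/2` for `ε' ≤ ε` -/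

/-- The critical four-arm probability is nonnegative. [folklore] -/
theorem critFourArmProb_nonneg (r₀ N : ℕ) : 0 ≤ critFourArmProb r₀ N := by
  unfold critFourArmProb polyArmProb
  exact MeasureTheory.measureReal_nonneg

/-- **Nolin 2008, Cor. 37 [arXiv 0711.4948: Cor. 35] (`L_ε ≍ L_{ε'}`), from Kesten's relation,
quasi-multiplicativity and the a priori four-arm bound.** If `Nolin2008_prop34` (Kesten's relation
`|p - 1/2| L_ε(p)² π₄(L_ε(p)) ≍ 1` at every `ε`), `Werner2009_fourArm_quasiMult` (Werner 2009, Cor. 6.2)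
and `Werner2009_fourArm_lowerBound` (Werner 2009, Lecture 6, §3) hold, then for
`0 < ε' ≤ ε < 1/2` there are `K` and `δ > 0` with `L_{ε'}(p) ≤ K · L_ε(p)` for all `p ≠ 1/2` with
`|p - 1/2| < δ` (`L_ε = charLength ε`; the reverse inequality `L_ε(p) ≤ L_{ε'}(p)` holds everywhere,
`charLength_anti`). Proof as printed (see the module docstring), with both four-arm estimates used
at `p = 1/2` and `K = max 4 (C₂ / (c_q c_l c₁ 4^{2-β}))^{1/β}`. [cite: Nolin2008, §7.3 Cor. 37 with its proof (arXiv 0711.4948: Cor. 35)] [cite: WernerPCMI2009, Lecture 6, §3 and Cor. 6.2] -/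
theorem charLength_le_mul_charLength_of_scaling (hK : Nolin2008_prop34)
    (hq : Werner2009_fourArm_quasiMult) (hl : Werner2009_fourArm_lowerBound)
    {ε' ε : ℝ} (hε' : 0 < ε') (hle : ε' ≤ ε) (hε : ε < 1 / 2) :
    ∃ K δ : ℝ, 0 < δ ∧ ∀ p : unitInterval, (p : ℝ) ≠ 1 / 2 → |(p : ℝ) - 1 / 2| < δ →
      (charLength ε' p : ℝ) ≤ K * charLength ε p := by
  have hε0 : 0 < ε := hε'.trans_le hle
  have hε'2 : ε' < 1 / 2 := hle.trans_lt hε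
  have hsub : Nolin2008_subcritical_crossing :=
    Nolin2008_subcritical_crossing_of_expDecay BollobasRiordan2006_tri_expDecay_holds
  -- quasi-multiplicativity and the a priori lower bound (used at `t = 1/2`)
  obtain ⟨εq, hεq, hQ⟩ := hq
  obtain ⟨rq, δq, hδq, cq, hcq, HQ⟩ := hQ (half_pos hεq) (half_lt_self hεq)
  obtain ⟨εl, hεl, hLB⟩ := hl
  obtain ⟨rl, δl, hδl, β, hβ, cl, hcl, HL⟩ := hLB (half_pos hεl) (half_lt_self hεl)
  -- Kesten's relation at `ε` and at `ε'`, with a common inner radius `r₀`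
  obtain ⟨r₁, H1⟩ := hK hε0 hε
  obtain ⟨r₁', H1'⟩ := hK hε' hε'2
  set r₀ : ℕ := max (max r₁ r₁') rq with hr₀
  obtain ⟨δ₁, hδ₁, c₁, hc₁, C₁, HB1⟩ := H1 r₀ ((le_max_left _ _).trans (le_max_left _ _))
  obtain ⟨δ₂, hδ₂, c₂, hc₂, C₂, HB2⟩ := H1' r₀ ((le_max_right _ _).trans (le_max_left _ _))
  have hrq : rq ≤ r₀ := le_max_right _ _
  -- `L_ε(p)` is large near `1/2`
  set M : ℕ := 4 * r₀ + rl + 1 with hM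
  have hev := (tendsto_charLength_atTop hK hε0 hε).eventually_ge_atTop M
  rw [eventually_nhdsWithin_iff, Metric.eventually_nhds_iff] at hev
  obtain ⟨δ₃, hδ₃, H3⟩ := hev
  -- the constants
  set Q : ℝ := C₂ / (cq * cl * c₁ * (4 : ℝ) ^ (2 - β)) with hQdef
  refine ⟨max 4 (Q ^ β⁻¹), min δ₁ (min δ₂ δ₃), lt_min hδ₁ (lt_min hδ₂ hδ₃), fun p hp hpδ => ?_⟩
  have hpδ₁ : |(p : ℝ) - 1 / 2| < δ₁ := hpδ.trans_le (min_le_left _ _)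
  have hpδ₂ : |(p : ℝ) - 1 / 2| < δ₂ := hpδ.trans_le ((min_le_right _ _).trans (min_le_left _ _))
  have hpδ₃ : |(p : ℝ) - 1 / 2| < δ₃ := hpδ.trans_le ((min_le_right _ _).trans (min_le_right _ _))
  have hML : M ≤ charLength ε p := by
    have h := H3 (show dist (p : ℝ) (1 / 2) < δ₃ by rwa [Real.dist_eq]) hp
    rwa [Set.projIcc_val zero_le_one p] at h
  set L : ℕ := charLength ε p with hLdef
  set L' : ℕ := charLength ε' p with hL'def
  have hLL' : L ≤ L' := charLength_anti hsub hε' hle hp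
  have hL4 : 16 * r₀ < 4 * L := by omega
  have hLrl : rl ≤ 4 * L := by omega
  have hLpos : (0 : ℝ) < L := by exact_mod_cast (show 0 < L by omega)
  have hL'pos : (0 : ℝ) < L' := by exact_mod_cast (show 0 < L' by omega)
  have hK4 : (4 : ℝ) ≤ max 4 (Q ^ β⁻¹) := le_max_left _ _
  by_cases hcase : L' ≤ 4 * L
  · calc (L' : ℝ) ≤ 4 * L := by exact_mod_cast hcase
      _ ≤ max 4 (Q ^ β⁻¹) * L := mul_le_mul_of_nonneg_right hK4 hLpos.le
  · push Not at hcase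
    have hapos : 0 < |(p : ℝ) - 1 / 2| := abs_pos.2 (sub_ne_zero.2 hp)
    obtain ⟨h1, -⟩ := HB1 p hp hpδ₁
    obtain ⟨-, h2⟩ := HB2 p hp hpδ₂
    have h3 := HQ half (by rw [coe_half]) (by rw [coe_half]; linarith) r₀ L L' hrq hL4 hcase
      (fun h => absurd h (by rw [coe_half]; exact lt_irrefl _))
    have h4 := HL half (by rw [coe_half]) (by rw [coe_half]; linarith) (4 * L) L' hLrl hcase.le
      (fun h => absurd h (by rw [coe_half]; exact lt_irrefl _))
    rw [fourArmProbAt_half, fourArmProbAt_half, fourArmProbAt_half] at h3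
    rw [fourArmProbAt_half] at h4
    push_cast at h4
    have hx := ratio_rpow_le_of_scaling hapos hLpos hL'pos (critFourArmProb_nonneg r₀ L) hc₁ hcq
      hcl hβ h1 h2 h3 h4
    calc (L' : ℝ) ≤ Q ^ β⁻¹ * L := hx
      _ ≤ max 4 (Q ^ β⁻¹) * L := mul_le_mul_of_nonneg_right (le_max_right _ _) hLpos.le

/-! ### Lemma 39 and the radius decay at every `ε` from the four leaves -/

/-- **Nolin's Lemma 39 / Remark 40 at EVERY `ε < 1/2` from the current leaves** (for `ε ≤ 0` the
statement is covered by the RSW threshold `ε ≤ ε₀`; for `ε ∈ (0, 1/2)` it is Nolin's): the RSW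
clause `Nolin2008_RSW_one` (Lemma 39 for `ε ≤ ε₀`, `Nolin2008_lemma39_at_of_RSW_one`), and — for
`ε > ε₀`, as in the last paragraph of Nolin's proof — the equivalence of lengths
(`charLength_le_mul_charLength_of_scaling`, from `Nolin2008_prop34`, `Werner2009_fourArm_quasiMult`,
`Werner2009_fourArm_lowerBound`) through `Nolin2008_lemma39_at_of_charLength_le`. [cite: Nolin2008, §7.4 Lemma 39 / Remark 40 with the last paragraph of the proof, §7.3 Cor. 37 (arXiv 0711.4948: Lemma 37 / Remark 38, Cor. 35)] -/
theorem Nolin2008_lemma39_at_of_leaves (hRSW1 : Nolin2008_RSW_one) (hK : Nolin2008_prop34)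
    (hq : Werner2009_fourArm_quasiMult) (hl : Werner2009_fourArm_lowerBound)
    {ε : ℝ} (hε' : ε < 1 / 2) : Nolin2008_lemma39_at ε := by
  obtain ⟨ε₀, hε₀, h37⟩ := Nolin2008_lemma39_at_of_RSW_one hRSW1
  by_cases hsmall : ε ≤ ε₀
  · exact h37 ε hsmall
  · have hlt : ε₀ < ε := not_le.1 hsmall
    obtain ⟨K, δ, hδ, hcomp⟩ := charLength_le_mul_charLength_of_scaling hK hq hl hε₀ hlt.le hε'
    refine Nolin2008_lemma39_at_of_charLength_le hε₀ hlt.le (h37 ε₀ le_rfl) hδ (C := K) ?_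
    intro p hp1 hp2
    exact hcomp p hp2.ne (by rw [abs_lt]; constructor <;> linarith)

/-- **`Nolin2008_radius_decay` from the current leaves.** The radius decay of the finite cluster
of the origin beyond `k · L_ε(p)` for EVERY `ε ∈ (0, 1/2)` (Nolin 2008, §7.5, proof of Lemma 44
[arXiv: Lemma 42]) follows from four named facts of the tree: `Nolin2008_RSW_one`,
`Nolin2008_prop34`, `Werner2009_fourArm_quasiMult`, `Werner2009_fourArm_lowerBound` — Lemma 39 at
every `ε` (`Nolin2008_lemma39_at_of_leaves`) and both halves of the radius decay
(`Nolin2008_radius_decay_at_of_lemma39_at'`). The discharge `Nolin2008_radius_decay_holds` is this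
theorem applied to the discharges of the four leaves. [cite: Nolin2008, §7.5 proof of Lemma 44, §7.4 Lemma 39, §7.3 Cor. 37 (arXiv 0711.4948: Lemma 42, Lemma 37, Cor. 35)] -/
theorem Nolin2008_radius_decay_of_leaves (hRSW1 : Nolin2008_RSW_one) (hK : Nolin2008_prop34)
    (hq : Werner2009_fourArm_quasiMult) (hl : Werner2009_fourArm_lowerBound) :
    Nolin2008_radius_decay := fun _ε _hε hε' =>
  Nolin2008_radius_decay_at_of_lemma39_at' (Nolin2008_lemma39_at_of_leaves hRSW1 hK hq hl hε')

/-- **`Nolin2008_radius_decay` from the leaves, pivotal-count form**: as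
`Nolin2008_radius_decay_of_leaves`, with Kesten's relation `Nolin2008_prop34` supplied by the
near-critical pivotal count `Werner2009_lemma62` (`Nolin2008_prop34_of_expDecay` with the proved
sub-critical decay `BollobasRiordan2006_tri_expDecay_holds`). [cite: Nolin2008, §7.5 proof of Lemma 44, §7.3 Prop. 34 and Cor. 37 (arXiv 0711.4948: Lemma 42, Prop. 32, Cor. 35)] [cite: WernerPCMI2009, Lecture 6, Lemma 6.2, §3 and Cor. 6.2] -/
theorem Nolin2008_radius_decay_of_leaves' (hRSW1 : Nolin2008_RSW_one) (h62 : Werner2009_lemma62)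
    (hq : Werner2009_fourArm_quasiMult) (hl : Werner2009_fourArm_lowerBound) :
    Nolin2008_radius_decay :=
  Nolin2008_radius_decay_of_leaves hRSW1
    (Nolin2008_prop34_of_expDecay BollobasRiordan2006_tri_expDecay_holds h62) hq hl

end Literature.Probability.Percolation
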